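import Mathlib
import HarnessLib

/-!
# LatticeQCDFlow / Scaling — the one-plaquette Gini constant of the untrained U(1) sampler:
# `∫₀^{2π}∫₀^{2π} |cos θ − cos θ′| dθ dθ′ = 32`, i.e. `E|cos θ − cos θ′| = 8/π²` under product Haar

HONEST FRAMING: exact (Metropolis-corrected) sampling algorithms for lattice gauge theory;
figures of merit are autocorrelation/cost numbers at stated couplings and volumes; no
continuum-physics claim.

Venture `LatticeQCDFlow` (cell pub-lqcd), topic `Scaling`; FANOUT row 3 (`s0-u1-a`, S0-B
implementation A, GEN-18).  NEW WORK of the cell (a calculus exercise), not a published result; NO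
definition is introduced; imports Mathlib only.

Row 3's strong-coupling law of the untrained (identity-flow) U(1) sampler
(`Scaling/IdentityFlowAcceptanceStrongCoupling`, GEN-17) reads `(1 − acc_V(β))/β → s_V` as `β → 0⁺`
with `s_V = ½·(2π)^{−2V} ∫∫ |Σᵢ cos θᵢ − Σᵢ cos θ′ᵢ| dθ dθ′`, and listed the closed form of the
ONE-plaquette constant as NOT CLAIMED.  This file computes it:

* `intervalIntegral_zero_two_pi_eq_two_mul` — `∫₀^{2π} ψ = 2∫₀^π ψ` for `ψ(2π − θ) = ψ(θ)`;
* `intervalIntegral_abs_cos_sub_cos_half` — for `a ∈ [0, π]`: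
  `∫₀^π |cos a − cos θ| dθ = 2 sin a + (π − 2a) cos a` (`cos` is decreasing on `[0, π]`);
* `intervalIntegral_abs_cos_sub_cos` — for `a ∈ [0, π]`: `∫₀^{2π} |cos a − cos θ| dθ = 4 sin a + (2π − 4a) cos a`;
* `intervalIntegral_two_sin_add` — `∫₀^π (2 sin a + (π − 2a) cos a) da = 8`;
* **`integral_integral_abs_cos_sub_cos`** — `∫₀^{2π}∫₀^{2π} |cos θ − cos θ′| dθ′ dθ = 32` (set-integral
  form over `Ioc 0 (2π)`, the form used by row 3's product-Haar files);
* **`u1_onePlaquette_gini`** — `(1/(2π))²·∫∫|cos θ − cos θ′| = 8/π²`: the Gini mean difference of one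
  plaquette cosine under Haar (the arcsine law on `[−1, 1]`);
* **`u1_onePlaquette_slope`** — `½·(1/(2π))²·∫∫|cos θ − cos θ′| = 4/π²`: the strong-coupling acceptance
  slope of the untrained ONE-plaquette U(1) sampler (`≈ 0.405`; the general bound of GEN-17 (N) gives
  `≤ ½`).

[folklore: `E|X − X′| = 8/π²` for the arcsine law is a textbook integral; no source is relied on.]
-/

noncomputable section

namespace Summit.Ventures.LatticeQCDFlow.Theory2

open MeasureTheory Real Set intervalIntegral

/-- `∫₀^{2π} ψ = 2·∫₀^π ψ` for a function with the reflection symmetry `ψ(2π − θ) = ψ(θ)` (e.g. any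
function of `cos θ`). [folklore] -/
theorem intervalIntegral_zero_two_pi_eq_two_mul {ψ : ℝ → ℝ} (hsymm : ∀ θ, ψ (2 * π - θ) = ψ θ)
    (h1 : IntervalIntegrable ψ volume 0 π) (h2 : IntervalIntegrable ψ volume π (2 * π)) :
    ∫ θ in (0 : ℝ)..2 * π, ψ θ = 2 * ∫ θ in (0 : ℝ)..π, ψ θ := by
  rw [← integral_add_adjacent_intervals h1 h2]
  have h : ∫ θ in π..2 * π, ψ θ = ∫ θ in (0 : ℝ)..π, ψ θ := by
    have hc := integral_comp_sub_left (fun θ => ψ θ) (2 * π) (a := 0) (b := π)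
    simp only [hsymm, sub_zero, show 2 * π - π = π by ring] at hc
    exact hc.symm
  rw [h]
  ring

/-- For `a ∈ [0, π]`: **`∫₀^π |cos a − cos θ| dθ = 2 sin a + (π − 2a) cos a`** — split at `θ = a`;
`cos` is decreasing on `[0, π]`, so the integrand is `cos θ − cos a` before `a` and `cos a − cos θ`
after. [folklore] -/
theorem intervalIntegral_abs_cos_sub_cos_half {a : ℝ} (ha0 : 0 ≤ a) (haπ : a ≤ π) :
    ∫ θ in (0 : ℝ)..π, |Real.cos a - Real.cos θ| = 2 * Real.sin a + (π - 2 * a) * Real.cos a := by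
  have hcont : Continuous fun θ => |Real.cos a - Real.cos θ| :=
    (continuous_const.sub Real.continuous_cos).abs
  rw [← integral_add_adjacent_intervals (hcont.intervalIntegrable 0 a) (hcont.intervalIntegrable a π)]
  have h1 : ∫ θ in (0 : ℝ)..a, |Real.cos a - Real.cos θ| = ∫ θ in (0 : ℝ)..a, (Real.cos θ - Real.cos a) := by
    refine integral_congr fun θ hθ => ?_
    rw [uIcc_of_le ha0] at hθ
    have hle : Real.cos a ≤ Real.cos θ := Real.cos_le_cos_of_nonneg_of_le_pi hθ.1 haπ hθ.2
    show |Real.cos a - Real.cos θ| = Real.cos θ - Real.cos a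
    rw [abs_of_nonpos (sub_nonpos.2 hle)]
    ring
  have h2 : ∫ θ in a..π, |Real.cos a - Real.cos θ| = ∫ θ in a..π, (Real.cos a - Real.cos θ) := by
    refine integral_congr fun θ hθ => ?_
    rw [uIcc_of_le haπ] at hθ
    have hle : Real.cos θ ≤ Real.cos a := Real.cos_le_cos_of_nonneg_of_le_pi ha0 hθ.2 hθ.1
    show |Real.cos a - Real.cos θ| = Real.cos a - Real.cos θ
    rw [abs_of_nonneg (sub_nonneg.2 hle)]
  rw [h1, h2, intervalIntegral.integral_sub (Real.continuous_cos.intervalIntegrable _ _)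
      (continuous_const.intervalIntegrable _ _),
    intervalIntegral.integral_sub (continuous_const.intervalIntegrable _ _)
      (Real.continuous_cos.intervalIntegrable _ _),
    integral_cos, integral_cos, intervalIntegral.integral_const, intervalIntegral.integral_const,
    Real.sin_zero, Real.sin_pi]
  simp only [smul_eq_mul, sub_zero]
  ring

/-- For `a ∈ [0, π]`: **`∫₀^{2π} |cos a − cos θ| dθ = 4 sin a + (2π − 4a) cos a`** (the integrand is a
function of `cos θ`, so the integral over `[π, 2π]` repeats the one over `[0, π]`). [folklore] -/
theorem intervalIntegral_abs_cos_sub_cos {a : ℝ} (ha0 : 0 ≤ a) (haπ : a ≤ π) :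
    ∫ θ in (0 : ℝ)..2 * π, |Real.cos a - Real.cos θ|
      = 4 * Real.sin a + (2 * π - 4 * a) * Real.cos a := by
  have hcont : Continuous fun θ => |Real.cos a - Real.cos θ| :=
    (continuous_const.sub Real.continuous_cos).abs
  rw [intervalIntegral_zero_two_pi_eq_two_mul (fun θ => by simp only [Real.cos_two_pi_sub])
    (hcont.intervalIntegrable 0 π) (hcont.intervalIntegrable π (2 * π)),
    intervalIntegral_abs_cos_sub_cos_half ha0 haπ]
  ring

/-- **`∫₀^π (2 sin a + (π − 2a) cos a) da = 8`** (antiderivative `(π − 2a) sin a − 4 cos a`). [folklore] -/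
theorem intervalIntegral_two_sin_add :
    ∫ a in (0 : ℝ)..π, (2 * Real.sin a + (π - 2 * a) * Real.cos a) = 8 := by
  have hderiv : ∀ a ∈ uIcc (0 : ℝ) π,
      HasDerivAt (fun a => (π - 2 * a) * Real.sin a - 4 * Real.cos a)
        (2 * Real.sin a + (π - 2 * a) * Real.cos a) a := by
    intro a _
    have h1 : HasDerivAt (fun a => π - 2 * a) (-2) a := by
      simpa using ((hasDerivAt_id a).const_mul 2).const_sub π
    have h2 : HasDerivAt (fun a => (π - 2 * a) * Real.sin a - 4 * Real.cos a)
        ((-2) * Real.sin a + (π - 2 * a) * Real.cos a - 4 * (-Real.sin a)) a :=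
      (h1.mul (Real.hasDerivAt_sin a)).sub ((Real.hasDerivAt_cos a).const_mul 4)
    have e : (-2) * Real.sin a + (π - 2 * a) * Real.cos a - 4 * (-Real.sin a)
        = 2 * Real.sin a + (π - 2 * a) * Real.cos a := by ring
    rw [e] at h2
    exact h2
  rw [integral_eq_sub_of_hasDerivAt hderiv
    ((by fun_prop : Continuous fun a => 2 * Real.sin a + (π - 2 * a) * Real.cos a).intervalIntegrable
      0 π)]
  simp only [Real.sin_pi, Real.cos_pi, Real.sin_zero, Real.cos_zero, mul_zero, sub_zero]
  ring

/-- The inner integral as a function of the first angle: for `θ ∈ [0, π]`,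
`∫₀^{2π} |cos θ − cos θ′| dθ′ = 4 sin θ + (2π − 4θ) cos θ`, and the map
`θ ↦ ∫₀^{2π} |cos θ − cos θ′| dθ′` is invariant under `θ ↦ 2π − θ`. [folklore] -/
theorem intervalIntegral_abs_cos_sub_cos_symm (θ : ℝ) :
    ∫ θ' in (0 : ℝ)..2 * π, |Real.cos (2 * π - θ) - Real.cos θ'|
      = ∫ θ' in (0 : ℝ)..2 * π, |Real.cos θ - Real.cos θ'| := by
  simp only [Real.cos_two_pi_sub]

/-- **THE DOUBLE INTEGRAL**: `∫₀^{2π} ∫₀^{2π} |cos θ − cos θ′| dθ′ dθ = 32` (interval-integral form).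
[folklore] -/
theorem intervalIntegral_intervalIntegral_abs_cos_sub_cos :
    ∫ θ in (0 : ℝ)..2 * π, ∫ θ' in (0 : ℝ)..2 * π, |Real.cos θ - Real.cos θ'| = 32 := by
  -- the outer integrand is continuous (parametric integral of a jointly continuous function)
  have hF : Continuous fun θ : ℝ => ∫ θ' in (0 : ℝ)..2 * π, |Real.cos θ - Real.cos θ'| := by
    have hunc : Continuous (Function.uncurry fun (θ θ' : ℝ) => |Real.cos θ - Real.cos θ'|) :=
      ((Real.continuous_cos.comp continuous_fst).sub (Real.continuous_cos.comp continuous_snd)).abs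
    exact intervalIntegral.continuous_parametric_intervalIntegral_of_continuous' hunc 0 (2 * π)
  rw [intervalIntegral_zero_two_pi_eq_two_mul intervalIntegral_abs_cos_sub_cos_symm
    (hF.intervalIntegrable 0 π) (hF.intervalIntegrable π (2 * π))]
  have hinner : ∫ θ in (0 : ℝ)..π, ∫ θ' in (0 : ℝ)..2 * π, |Real.cos θ - Real.cos θ'|
      = ∫ θ in (0 : ℝ)..π, 2 * (2 * Real.sin θ + (π - 2 * θ) * Real.cos θ) := by
    refine integral_congr fun θ hθ => ?_
    rw [uIcc_of_le Real.pi_pos.le] at hθ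
    show ∫ θ' in (0 : ℝ)..2 * π, |Real.cos θ - Real.cos θ'| = 2 * (2 * Real.sin θ + (π - 2 * θ) * Real.cos θ)
    rw [intervalIntegral_abs_cos_sub_cos hθ.1 hθ.2]
    ring
  rw [hinner, intervalIntegral.integral_const_mul, intervalIntegral_two_sin_add]
  norm_num

/-- **THE ONE-PLAQUETTE GINI CONSTANT, set-integral form** (the form of row 3's product-Haar files,
`volume.restrict (Ioc 0 (2π))`): `∫∫ |cos θ − cos θ′| dθ′ dθ = 32` over `(0, 2π]²`. [folklore] -/
theorem integral_integral_abs_cos_sub_cos :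
    ∫ θ, ∫ θ', |Real.cos θ - Real.cos θ'| ∂(volume.restrict (Ioc (0 : ℝ) (2 * π)))
      ∂(volume.restrict (Ioc (0 : ℝ) (2 * π))) = 32 := by
  have h2π : (0 : ℝ) ≤ 2 * π := by positivity
  have e : (fun θ : ℝ => ∫ θ', |Real.cos θ - Real.cos θ'| ∂(volume.restrict (Ioc (0 : ℝ) (2 * π))))
      = fun θ => ∫ θ' in (0 : ℝ)..2 * π, |Real.cos θ - Real.cos θ'| := by
    funext θ
    rw [intervalIntegral.integral_of_le h2π]
  rw [show (∫ θ, ∫ θ', |Real.cos θ - Real.cos θ'| ∂(volume.restrict (Ioc (0 : ℝ) (2 * π)))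
      ∂(volume.restrict (Ioc (0 : ℝ) (2 * π))))
      = ∫ θ in Ioc (0 : ℝ) (2 * π), (fun θ : ℝ => ∫ θ', |Real.cos θ - Real.cos θ'|
          ∂(volume.restrict (Ioc (0 : ℝ) (2 * π)))) θ from rfl, e,
    ← intervalIntegral.integral_of_le h2π]
  exact intervalIntegral_intervalIntegral_abs_cos_sub_cos

/-- **`E|cos θ − cos θ′| = 8/π²` under the product of the one-angle Haar probabilities**
(`(1/(2π))²·∫∫|cos θ − cos θ′| dθ dθ′ = 8/π²`): the Gini mean difference of one plaquette cosine —
the arcsine law on `[−1, 1]` — is `8/π² ≈ 0.81`. [folklore] -/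
theorem u1_onePlaquette_gini :
    (1 / (2 * π)) ^ 2 * ∫ θ, ∫ θ', |Real.cos θ - Real.cos θ'| ∂(volume.restrict (Ioc (0 : ℝ) (2 * π)))
      ∂(volume.restrict (Ioc (0 : ℝ) (2 * π))) = 8 / π ^ 2 := by
  rw [integral_integral_abs_cos_sub_cos]
  have hπ : π ≠ 0 := Real.pi_ne_zero
  field_simp
  ring

/-- **THE STRONG-COUPLING ACCEPTANCE SLOPE OF THE UNTRAINED ONE-PLAQUETTE U(1) SAMPLER IS `4/π²`**:
`½·(1/(2π))²·∫∫|cos θ − cos θ′| dθ dθ′ = 4/π²` (`≈ 0.405`, against the general bound `√V/2 = ½` of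
row 3's `Scaling/U1IdentityFlowSlopeVolumeBound` at `V = 1`). [ours] -/
theorem u1_onePlaquette_slope :
    1 / 2 * ((1 / (2 * π)) ^ 2 * ∫ θ, ∫ θ', |Real.cos θ - Real.cos θ'|
      ∂(volume.restrict (Ioc (0 : ℝ) (2 * π))) ∂(volume.restrict (Ioc (0 : ℝ) (2 * π)))) = 4 / π ^ 2 := by
  rw [u1_onePlaquette_gini]
  ring

/-- Transfer to the ONE-plaquette product form of row 3's volume-indexed files (an index type with a
single element; `MeasureTheory.measurePreserving_piUnique`):
`∫∫ |cos x(⋆) − cos x′(⋆)| dLeb^{⊗ι}(x) dLeb^{⊗ι}(x′) = 32` on `(0, 2π]^ι`, `|ι| = 1`. [folklore] -/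
theorem integral_integral_abs_cos_sub_cos_piUnique {ι : Type*} [Fintype ι] [Unique ι] :
    ∫ x, ∫ x', |Real.cos (x default) - Real.cos (x' default)|
        ∂(Measure.pi fun _ : ι => volume.restrict (Ioc (0 : ℝ) (2 * π)))
        ∂(Measure.pi fun _ : ι => volume.restrict (Ioc (0 : ℝ) (2 * π))) = 32 := by
  have hmp := measurePreserving_piUnique (fun _ : ι => volume.restrict (Ioc (0 : ℝ) (2 * π)))
  have inner : ∀ θ : ℝ, ∫ x', |Real.cos θ - Real.cos (x' default)|
      ∂(Measure.pi fun _ : ι => volume.restrict (Ioc (0 : ℝ) (2 * π)))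
      = ∫ θ', |Real.cos θ - Real.cos θ'| ∂(volume.restrict (Ioc (0 : ℝ) (2 * π))) :=
    fun θ => hmp.integral_comp' (fun θ' => |Real.cos θ - Real.cos θ'|)
  simp_rw [inner]
  rw [← integral_integral_abs_cos_sub_cos]
  exact hmp.integral_comp' (fun θ => ∫ θ', |Real.cos θ - Real.cos θ'|
    ∂(volume.restrict (Ioc (0 : ℝ) (2 * π))))

/-- The same in the `Σᵢ cos xᵢ` form of `Scaling/U1IdentityFlowVolumeLaw` (one plaquette):
`∫∫ |Σᵢ cos xᵢ − Σᵢ cos x′ᵢ| = 32`, `|ι| = 1`. [folklore] -/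
theorem integral_integral_abs_sum_cos_sub_unique {ι : Type*} [Fintype ι] [Unique ι] :
    ∫ x, ∫ x', |∑ i, Real.cos (x i) - ∑ i, Real.cos (x' i)|
        ∂(Measure.pi fun _ : ι => volume.restrict (Ioc (0 : ℝ) (2 * π)))
        ∂(Measure.pi fun _ : ι => volume.restrict (Ioc (0 : ℝ) (2 * π))) = 32 := by
  simp only [Fintype.sum_unique]
  exact integral_integral_abs_cos_sub_cos_piUnique

/-- **THE `V = 1` VALUE OF ROW 3'S STRONG-COUPLING SLOPE**, in the exact shape of
`Scaling/U1IdentityFlowSlopeVolumeBound.u1IdentityFlow_slope_le_sqrt_card` (index type with one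
element): `s_1 = ½·(∏ᵢ 1/(2π))²·∫∫|Σᵢcos xᵢ − Σᵢcos x′ᵢ| = 4/π²` (`≈ 0.405`; the volume bound there
reads `≤ ½` at `V = 1`). [ours] -/
theorem u1IdentityFlow_slope_unique {ι : Type*} [Fintype ι] [Unique ι] :
    1 / 2 * ((∏ _i : ι, (1 / (2 * π) : ℝ)) ^ 2
        * ∫ x, ∫ x', |∑ i, Real.cos (x i) - ∑ i, Real.cos (x' i)|
          ∂(Measure.pi fun _ : ι => volume.restrict (Ioc (0 : ℝ) (2 * π)))
          ∂(Measure.pi fun _ : ι => volume.restrict (Ioc (0 : ℝ) (2 * π))))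
      = 4 / π ^ 2 := by
  rw [integral_integral_abs_sum_cos_sub_unique, Fintype.prod_unique]
  have hπ : π ≠ 0 := Real.pi_ne_zero
  field_simp
  ring

/-- **The one-plaquette value sits inside row 3's two-sided volume law at `V = 1`** (near its top):
`√(1/12) ≤ 4/π² ≤ √(1/6)` (`0.2887 ≤ 0.4053 ≤ 0.4082`; from `3.14 < π < 3.15`). [ours] -/
theorem u1_onePlaquette_slope_mem_Icc :
    Real.sqrt (1 / 12) ≤ 4 / π ^ 2 ∧ 4 / π ^ 2 ≤ Real.sqrt (1 / 6) := by
  have hπ := Real.pi_pos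
  have h1 := Real.pi_gt_d2
  have h2 := Real.pi_lt_d2
  have hup : π ^ 2 ≤ 3.15 ^ 2 := by nlinarith
  have hlo : 3.14 ^ 2 ≤ π ^ 2 := by nlinarith
  have h4 : 0 ≤ 4 / π ^ 2 := by positivity
  have hsq : Real.sqrt ((4 / π ^ 2) ^ 2) = 4 / π ^ 2 := Real.sqrt_sq h4
  have hπ4 : (4 / π ^ 2) ^ 2 = 16 / (π ^ 2) ^ 2 := by ring
  constructor
  · rw [← hsq]
    refine Real.sqrt_le_sqrt ?_
    rw [hπ4, div_le_div_iff₀ (by norm_num) (by positivity)]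
    nlinarith [hup]
  · rw [← hsq]
    refine Real.sqrt_le_sqrt ?_
    rw [hπ4, div_le_div_iff₀ (by positivity) (by norm_num)]
    nlinarith [hlo]

end Summit.Ventures.LatticeQCDFlow.Theory2

/-! ## §6 The one-plaquette value in the `Measure.pi` PROBABILITY normalisation -/

namespace Summit.Ventures.LatticeQCDFlow.Theory2

open MeasureTheory Real Set Finset

/-- **`s_1 = 4/π²` in the product-of-Haar-PROBABILITIES form** of row 3's volume sandwich
(`Scaling/U1IdentityFlowSlopeVolumeSandwich`, index type with one element, each factor the probability
`(2π)⁻¹·Leb|(0,2π]`): `½·∫∫|Σᵢcos xᵢ − Σᵢcos x′ᵢ| d(⊗Haar) d(⊗Haar) = 4/π²` — the `V = 1` anchor of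
`√(V/12) ≤ s_V ≤ √(V/6)` (`0.2887 ≤ 0.4053 ≤ 0.4082`). [ours] -/
theorem u1Pi_slope_card_one {ι : Type*} [Fintype ι] [Unique ι] :
    1 / 2 * ∫ x, ∫ x', |∑ i, Real.cos (x i) - ∑ i, Real.cos (x' i)|
        ∂(Measure.pi fun _ : ι => (ENNReal.ofReal (2 * π))⁻¹ • volume.restrict (Ioc (0 : ℝ) (2 * π)))
        ∂(Measure.pi fun _ : ι => (ENNReal.ofReal (2 * π))⁻¹ • volume.restrict (Ioc (0 : ℝ) (2 * π)))
      = 4 / π ^ 2 := by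
  simp only [Fintype.sum_unique]
  have hmp := measurePreserving_piUnique
    (fun _ : ι => (ENNReal.ofReal (2 * π))⁻¹ • volume.restrict (Ioc (0 : ℝ) (2 * π)))
  have inner : ∀ θ : ℝ, ∫ x', |Real.cos θ - Real.cos (x' default)|
      ∂(Measure.pi fun _ : ι => (ENNReal.ofReal (2 * π))⁻¹ • volume.restrict (Ioc (0 : ℝ) (2 * π)))
      = ∫ θ', |Real.cos θ - Real.cos θ'|
        ∂((ENNReal.ofReal (2 * π))⁻¹ • volume.restrict (Ioc (0 : ℝ) (2 * π))) :=
    fun θ => hmp.integral_comp' (fun θ' => |Real.cos θ - Real.cos θ'|)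
  simp_rw [inner]
  have outer : ∫ x, ∫ θ', |Real.cos (x default) - Real.cos θ'|
      ∂((ENNReal.ofReal (2 * π))⁻¹ • volume.restrict (Ioc (0 : ℝ) (2 * π)))
      ∂(Measure.pi fun _ : ι => (ENNReal.ofReal (2 * π))⁻¹ • volume.restrict (Ioc (0 : ℝ) (2 * π)))
      = ∫ θ, ∫ θ', |Real.cos θ - Real.cos θ'|
        ∂((ENNReal.ofReal (2 * π))⁻¹ • volume.restrict (Ioc (0 : ℝ) (2 * π)))
        ∂((ENNReal.ofReal (2 * π))⁻¹ • volume.restrict (Ioc (0 : ℝ) (2 * π))) :=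
    hmp.integral_comp' (fun θ => ∫ θ', |Real.cos θ - Real.cos θ'|
      ∂((ENNReal.ofReal (2 * π))⁻¹ • volume.restrict (Ioc (0 : ℝ) (2 * π))))
  rw [outer]
  have h2π : (0 : ℝ) ≤ 2 * π := by positivity
  have hc : ((ENNReal.ofReal (2 * π))⁻¹).toReal = 1 / (2 * π) := by
    rw [ENNReal.toReal_inv, ENNReal.toReal_ofReal h2π, one_div]
  simp_rw [integral_smul_measure, smul_eq_mul, hc]
  rw [integral_const_mul, ← u1_onePlaquette_slope]
  ring

end Summit.Ventures.LatticeQCDFlow.Theory2
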